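import Summits.AnomalousDissipation.AnomalousDissipation.Theorems.SolenoidalFractalHomogenisationLagrangianStepSidebandQSKernel
import Summits.AnomalousDissipation.AnomalousDissipation.Theorems.SolenoidalFractalHomogenisationLagrangianStepSidebandMeanSlot
import Summits.AnomalousDissipation.AnomalousDissipation.Theorems.SolenoidalFractalHomogenisationLagrangianStepSidebandSlotTime
import Summits.AnomalousDissipation.AnomalousDissipation.Theorems.SolenoidalFractalHomogenisationLagrangianStepSidebandResponse
import HarnessLib

/-!
# K1L_D `stub_D1_residueTail` (registry v17, stmt-AnomalousDissipation-27980) — lane A1 ASSEMBLY G13-1: THE DIAGONAL OF THE PERIOD-MEAN FEEDBACK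
# IS THE `excQS` SLOT TERM PLUS THE WRAP-AROUND MEMORY, EXACTLY (`κ = 1`) (helper; `--supports stmt-AnomalousDissipation-27980`)

Summits-side helper file of route `SolenoidalFractalHomogenisation` (prover seat `ad-sawtooth-k1loc-p1` g13; lane A of the tail certificate
`Lines/onelevel-D1-tail-cert.md`, case C; variant A of D26-7; `κ = 1` derived by p1 g12 and confirmed numerically, kit j322426/j322440).  Everything proved;
no definitions, no named facts, no sorry.  For a word `W`, a pre-stretch `M > 0`, `ν > 0`, a background shape `S` in a window `NearIso S lo hi` (`lo > 0`),
`W₁ = (W.stretch M).stretch (1/ν)`, `𝔸 = ν•S`, `γ₁ = 1`, `R = R0 ν`, `N = response W₁ 𝔸 1 R j`, slot `j` with `±mⱼ` retained: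
* `period_stretch_stretch`, `tau_stretch_stretch` — `W₁.period = M·P_W/ν`, `τ¹ⱼ = M τⱼ/ν`;
* **`meanFeedback_diag_apply`** — for every `v ∈ ℂ³`:
  `M_{jj} v = ((4π²/ν)·slotCoef W j) • cmat(slotQ W M S j) v + (1/P₁) • ∫_{startⱼ}^{startⱼ+τ¹ⱼ} wrapⱼ(t) v dt`,
  `wrapⱼ(t) v = 2πi envⱼ(t) • (αⱼ • exp((t−startⱼ)Bⱼ)(N startⱼ v)_{−mⱼ} + ᾱⱼ • exp((t−startⱼ)Bⱼ)(N startⱼ v)_{mⱼ})` — the own-slot FRESH part of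
  `M_{jj} = (1/P₁)∫ feedbackⱼ ∘ Nⱼ` is EXACTLY `(4π²/ν)·(slotCoefⱼ · slotQⱼ)`, i.e. `(ν/4π²)·diag psiStar = excQS` slot by slot (`κ = 1`); what is left is
  the image of the state at the slot start, which `…SidebandMask` / `…SidebandDecay` make `e^{−(rP₁ − θⱼ)}`-small.
Chain: `meanFeedback_eq_slot_integral` (p690833) → `feedback_response_eq_of_mem_slot` (p690140) → `double_integral_slot_subst` (p693416) →
`integral_integral_exp_blockGen_eq` (`…SidebandQSKernel`) → constants `(1/P₁)·8π²|αⱼ|²·L²/T = τⱼ/(8π²|mⱼ|⁴ P_W ν) = (4π²/ν)·slotCoefⱼ`.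
NOT a proof of any registered stub, of the crux, or of anomalous dissipation; rung leaf F-D1 infrastructure.
-/

set_option linter.dupNamespace false

noncomputable section

namespace Summit.AnomalousDissipation.AnomalousDissipation.Theorems.SolenoidalFractalHomogenisation.LagrangianStep.Sideband

open Set MeasureTheory Complex NormedSpace intervalIntegral
open scoped InnerProductSpace
open Literature.Analysis Literature.Analysis.FunctionSpaces Literature.Analysis.FunctionSpaces.Torus
open Literature.Analysis.FluidPDE Literature.Analysis.FluidPDE.Torus Literature.Analysis.FluidPDE.LatticeShear
open Summit.AnomalousDissipation.AnomalousDissipation.Theorems.SolenoidalFractalHomogenisation.PermissibleCarrier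
  (start_nonneg start_add_tau_le_period period_pos trapezoid_eq_zero_of_ge)

variable {k₀ : ℕ}

/-! ## §1 Slot data of the doubly stretched word -/

/-- `((W.stretch M).stretch (1/ν)).period = M · W.period / ν`. [folklore] -/
theorem period_stretch_stretch (W : LatticeWord k₀) {M ν : ℝ} (hM : 0 < M) (hν : 0 < ν) :
    ((W.stretch M hM).stretch (1 / ν) (one_div_pos.mpr hν)).period = M * W.period / ν := by
  unfold LatticeWord.period LatticeWord.stretch
  simp only [Finset.mul_sum, Finset.sum_div]
  exact Finset.sum_congr rfl fun i _ => by ring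

/-- `τ¹ⱼ = M τⱼ / ν` for the doubly stretched word. [folklore] -/
theorem tau_stretch_stretch (W : LatticeWord k₀) {M ν : ℝ} (hM : 0 < M) (hν : 0 < ν) (j : Fin k₀) :
    (((W.stretch M hM).stretch (1 / ν) (one_div_pos.mpr hν)).phase j).τ = M * (W.phase j).τ / ν := by
  show 1 / ν * (M * (W.phase j).τ) = _
  ring

/-! ## §2 The fresh part of the own-slot feedback, integrated over the slot -/

/-- On `[startⱼ, startⱼ + τⱼ]` (first period) the envelope of slot `j` is the plain trapezoid (including the right endpoint, where both vanish). [folklore] -/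
theorem slotEnvelope_eq_trapezoid_of_mem_Icc (W₁ : LatticeWord k₀) (j : Fin k₀) {t : ℝ}
    (ht : t ∈ Icc (W₁.start j) (W₁.start j + (W₁.phase j).τ)) :
    slotEnvelope W₁ j t = LatticeWord.trapezoid (W₁.start j) (W₁.phase j).τ W₁.ramp t := by
  rcases lt_or_eq_of_le ht.2 with h | h
  · exact slotEnvelope_eq_trapezoid_of_mem_slot W₁ j ⟨ht.1, h⟩
  · rw [h, slotEnvelope_eq_zero_of_end_le W₁ j le_rfl (start_add_tau_le_period W₁ j),
      trapezoid_eq_zero_of_ge (mul_pos W₁.ramp_pos (W₁.phase j).τ_pos) le_rfl]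

/-- **THE FRESH OWN-SLOT PART, INTEGRATED OVER THE SLOT, IS `(4π²/ν)·P₁·slotCoefⱼ • cmat(slotQⱼ)`.**  With `W₁ = (W.stretch M).stretch (1/ν)`,
`Bⱼ = blockGen (ν•S) γ₁ mⱼ`, `envⱼ` the envelope of slot `j` of `W₁`:
`∫_{startⱼ}^{startⱼ+τ¹ⱼ} (8π²|αⱼ|² envⱼ(t)) • ∫_{startⱼ}^{t} envⱼ(s) • exp((t−s)Bⱼ)(P v) ds dt = ((4π²/ν)·(M P_W/ν)·slotCoef W j) • cmat(slotQ W M S j) v`.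
[cite: MajdaKramer1999, §2.2.1.3 (55) (effective diffusivity as a cell average)] [cite: Hale1980, Ch. III §1, Theorem 1.1] -/
theorem integral_fresh_eq (W : LatticeWord k₀) {M ν : ℝ} (hM : 0 < M) (hν : 0 < ν) (S : Torus.Visc4 (Fin 3)) (γ₁ : ℝ) (j : Fin k₀)
    (v : EuclideanSpace ℂ (Fin 3)) :
    let W₁ := (W.stretch M hM).stretch (1 / ν) (one_div_pos.mpr hν)
    ∫ t in W₁.start j..W₁.start j + (W₁.phase j).τ,
        (((8 * Real.pi ^ 2 * Complex.normSq (slotAmp W₁ j) * slotEnvelope W₁ j t : ℝ) : ℂ)) •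
          ∫ s in W₁.start j..t, ((slotEnvelope W₁ j s : ℝ) : ℂ) •
            exp ((t - s) • (blockGen (ν • S) γ₁ (W₁.phase j).m).restrictScalars ℝ) (transversalProj (W₁.phase j).m v) =
      (((4 * Real.pi ^ 2 / ν) * (M * W.period / ν) * slotCoef W j : ℝ) : ℂ) •
        Matrix.toEuclideanCLM (n := Fin 3) (𝕜 := ℂ) ((slotQ W M S j).map ((↑) : ℝ → ℂ)) v := by
  intro W₁
  set t₀ := W₁.start j with ht₀
  set L := (W₁.phase j).τ with hLdef
  have hL : 0 < L := (W₁.phase j).τ_pos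
  have hLval : L = M * (W.phase j).τ / ν := tau_stretch_stretch W hM hν j
  set Bℝ := (blockGen (ν • S) γ₁ (W₁.phase j).m).restrictScalars ℝ with hB
  set Pv := transversalProj (W₁.phase j).m v with hPv
  set c : ℝ := 8 * Real.pi ^ 2 * Complex.normSq (slotAmp W₁ j) with hc
  -- the lag kernel
  obtain ⟨K, hK⟩ : ∃ K : ℝ → EuclideanSpace ℂ (Fin 3), K = fun σ => exp (σ • Bℝ) Pv := ⟨_, rfl⟩
  -- Step 1: real scalars and the plain trapezoid on the slot
  have henv : ∀ t ∈ Icc t₀ (t₀ + L), slotEnvelope W₁ j t = LatticeWord.trapezoid t₀ L W₁.ramp t :=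
    fun t ht => slotEnvelope_eq_trapezoid_of_mem_Icc W₁ j ht
  have h1 : ∫ t in t₀..t₀ + L, (((c * slotEnvelope W₁ j t : ℝ) : ℂ)) • ∫ s in t₀..t, ((slotEnvelope W₁ j s : ℝ) : ℂ) • exp ((t - s) • Bℝ) Pv =
      c • ∫ t in t₀..t₀ + L, LatticeWord.trapezoid t₀ L W₁.ramp t • ∫ s in t₀..t, LatticeWord.trapezoid t₀ L W₁.ramp s • K (t - s) := by
    rw [← intervalIntegral.integral_smul]
    refine intervalIntegral.integral_congr fun t ht => ?_
    rw [uIcc_of_le (by linarith)] at ht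
    show (((c * slotEnvelope W₁ j t : ℝ) : ℂ)) • ∫ s in t₀..t, ((slotEnvelope W₁ j s : ℝ) : ℂ) • exp ((t - s) • Bℝ) Pv =
      c • (LatticeWord.trapezoid t₀ L W₁.ramp t • ∫ s in t₀..t, LatticeWord.trapezoid t₀ L W₁.ramp s • K (t - s))
    rw [Complex.coe_smul, henv t ht, smul_smul]
    congr 1
    refine intervalIntegral.integral_congr fun s hs => ?_
    rw [uIcc_of_le ht.1] at hs
    show ((slotEnvelope W₁ j s : ℝ) : ℂ) • exp ((t - s) • Bℝ) Pv = LatticeWord.trapezoid t₀ L W₁.ramp s • K (t - s)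
    rw [Complex.coe_smul, henv s ⟨hs.1, hs.2.trans ht.2⟩, hK]
  -- Step 2: slot-time substitution
  have h2 := double_integral_slot_subst hL t₀ W₁.ramp K
  -- Step 3: the kernel identity
  have hTL : L * (4 * Real.pi ^ 2 * ν * ‖latticeVec (W₁.phase j).m‖ ^ 2) ≠ 0 := by
    have := norm_latticeVec_pos (W₁.phase j); positivity
  have h3 : ∫ u in (0:ℝ)..1, LatticeWord.trapezoid 0 1 W₁.ramp u • ∫ x in (0:ℝ)..u, LatticeWord.trapezoid 0 1 W₁.ramp x • K (L * (u - x)) =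
      ((L * (4 * Real.pi ^ 2 * ν * ‖latticeVec (W₁.phase j).m‖ ^ 2))⁻¹ : ℂ) •
        Matrix.toEuclideanCLM (n := Fin 3) (𝕜 := ℂ)
          ((qsResp W₁.ramp (L * (4 * Real.pi ^ 2 * ν * ‖latticeVec (W₁.phase j).m‖ ^ 2)) (regBlock S (mhat (W₁.phase j))) *
            projPerp (mhat (W₁.phase j))).map ((↑) : ℝ → ℂ)) v := by
    rw [hK]
    exact integral_integral_exp_blockGen_eq S ν γ₁ (W₁.phase j) W₁.ramp hTL v
  -- Step 4: identify `slotQ` and the scalar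
  have hT : L * (4 * Real.pi ^ 2 * ν * ‖latticeVec (W₁.phase j).m‖ ^ 2) = 4 * Real.pi ^ 2 * ‖latticeVec (W.phase j).m‖ ^ 2 * M * (W.phase j).τ := by
    rw [hLval]
    show M * (W.phase j).τ / ν * (4 * Real.pi ^ 2 * ν * ‖latticeVec (W.phase j).m‖ ^ 2) = _
    field_simp
  have hQ : qsResp W₁.ramp (L * (4 * Real.pi ^ 2 * ν * ‖latticeVec (W₁.phase j).m‖ ^ 2)) (regBlock S (mhat (W₁.phase j))) *
      projPerp (mhat (W₁.phase j)) = slotQ W M S j := by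
    rw [hT]; rfl
  rw [show (fun t => (((8 * Real.pi ^ 2 * Complex.normSq (slotAmp W₁ j) * slotEnvelope W₁ j t : ℝ) : ℂ)) •
      ∫ s in t₀..t, ((slotEnvelope W₁ j s : ℝ) : ℂ) • exp ((t - s) • Bℝ) Pv) =
      fun t => (((c * slotEnvelope W₁ j t : ℝ) : ℂ)) • ∫ s in t₀..t, ((slotEnvelope W₁ j s : ℝ) : ℂ) • exp ((t - s) • Bℝ) Pv from rfl]
  rw [h1, h2, h3, hQ]
  -- scalars: `c • L • L • (T⁻¹ : ℂ) • X = r • X`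
  have hm : 0 < ‖latticeVec (W.phase j).m‖ := norm_latticeVec_pos (W.phase j)
  have hcval : c = 1 / (2 * ‖latticeVec (W.phase j).m‖ ^ 2) := by rw [hc]; exact eight_pi_sq_mul_normSq_slotAmp W₁ j
  have hP : 0 < W.period := period_pos W
  have hmm : ‖latticeVec (W₁.phase j).m‖ = ‖latticeVec (W.phase j).m‖ := rfl
  have hX : ((L : ℂ) * (4 * (Real.pi : ℂ) ^ 2 * (ν : ℂ) * ((‖latticeVec (W₁.phase j).m‖ : ℝ) : ℂ) ^ 2))⁻¹ =
      ((((L * (4 * Real.pi ^ 2 * ν * ‖latticeVec (W₁.phase j).m‖ ^ 2))⁻¹ : ℝ)) : ℂ) := by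
    push_cast; ring
  rw [hX]
  simp only [Complex.coe_smul, smul_smul]
  congr 1
  rw [hcval, hLval, hmm, slotCoef]
  have hν0 : ν ≠ 0 := hν.ne'
  have hM0 : M ≠ 0 := hM.ne'
  have hm0 : ‖latticeVec (W.phase j).m‖ ≠ 0 := hm.ne'
  have hP0 : W.period ≠ 0 := hP.ne'
  have hτ0 : (W.phase j).τ ≠ 0 := (W.phase j).τ_pos.ne'
  have hπ0 : Real.pi ≠ 0 := Real.pi_pos.ne'
  field_simp
  ring

/-! ## §3 The diagonal of the period-mean feedback -/

/-- **THE DIAGONAL OF THE PERIOD-MEAN FEEDBACK** (`κ = 1`).  For `W₁ = (W.stretch M).stretch (1/ν)`, `𝔸 = ν•S` with `NearIso S lo hi`, `lo > 0`,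
`γ₁ = 1`, `R = R0 ν`, `N = response W₁ 𝔸 1 R j` and `±mⱼ` retained: for every `v ∈ ℂ³`,
`M_{jj} v = ((4π²/ν)·slotCoef W j) • cmat(slotQ W M S j) v + (1/P₁) • ∫_{startⱼ}^{startⱼ+τ¹ⱼ} wrapⱼ(t) v dt`, where
`wrapⱼ(t) v = 2πi envⱼ(t) • (αⱼ • exp((t−startⱼ)Bⱼ)(N startⱼ v)_{−mⱼ} + ᾱⱼ • exp((t−startⱼ)Bⱼ)(N startⱼ v)_{mⱼ})`.
[cite: MajdaKramer1999, §2.2.1.3 (55) (effective diffusivity as a cell average)] [cite: Hale1980, Ch. III §1, Theorem 1.1] -/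
theorem meanFeedback_diag_apply (W : LatticeWord k₀) {M ν : ℝ} (hM : 0 < M) (hν : 0 < ν) {S : Torus.Visc4 (Fin 3)} {lo hi : ℝ}
    (hS : Torus.NearIso S lo hi) (hlo : 0 < lo) (j : Fin k₀) (hm : (W.phase j).m ∈ box (R0 ν)) (hm' : -(W.phase j).m ∈ box (R0 ν))
    (v : EuclideanSpace ℂ (Fin 3)) :
    let W₁ := (W.stretch M hM).stretch (1 / ν) (one_div_pos.mpr hν)
    meanFeedback W₁ (ν • S) 1 (R0 ν) j j v =
      (((4 * Real.pi ^ 2 / ν) * slotCoef W j : ℝ) : ℂ) • Matrix.toEuclideanCLM (n := Fin 3) (𝕜 := ℂ) ((slotQ W M S j).map ((↑) : ℝ → ℂ)) v +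
      (1 / W₁.period) • ∫ t in W₁.start j..W₁.start j + (W₁.phase j).τ,
        (2 * Real.pi * Complex.I * ((slotEnvelope W₁ j t : ℝ) : ℂ)) •
          (slotAmp W₁ j • exp ((t - W₁.start j) • (blockGen (ν • S) 1 (W₁.phase j).m).restrictScalars ℝ)
              (coordL (R0 ν) (-(W₁.phase j).m) (response W₁ (ν • S) 1 (R0 ν) j (W₁.start j) v)) +
            starRingEnd ℂ (slotAmp W₁ j) • exp ((t - W₁.start j) • (blockGen (ν • S) 1 (W₁.phase j).m).restrictScalars ℝ)
              (coordL (R0 ν) (W₁.phase j).m (response W₁ (ν • S) 1 (R0 ν) j (W₁.start j) v))) := by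
  intro W₁
  have hN : IsPeriodicResponse W₁ (ν • S) 1 (R0 ν) j (response W₁ (ν • S) 1 (R0 ν) j) :=
    isPeriodicResponse_response_psiStar W M hM hν hS hlo j
  set N := response W₁ (ν • S) 1 (R0 ν) j with hNdef
  set t₀ := W₁.start j with ht₀
  set L := (W₁.phase j).τ with hLdef
  have hL : 0 < L := (W₁.phase j).τ_pos
  have h0 : 0 ≤ t₀ := start_nonneg W₁ j
  have h1P : t₀ + L ≤ W₁.period := start_add_tau_le_period W₁ j
  have hP : 0 < W₁.period := period_pos W₁
  set Bℝ := (blockGen (ν • S) 1 (W₁.phase j).m).restrictScalars ℝ with hB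
  -- the three integrands (opaque names)
  obtain ⟨tot, htot⟩ : ∃ f : ℝ → EuclideanSpace ℂ (Fin 3), f = fun t => feedback W₁ (R0 ν) j t (N t v) := ⟨_, rfl⟩
  obtain ⟨fresh, hfresh⟩ : ∃ f : ℝ → EuclideanSpace ℂ (Fin 3), f = fun t =>
      (((8 * Real.pi ^ 2 * Complex.normSq (slotAmp W₁ j) * slotEnvelope W₁ j t : ℝ) : ℂ)) •
        ∫ s in t₀..t, ((slotEnvelope W₁ j s : ℝ) : ℂ) • exp ((t - s) • Bℝ) (transversalProj (W₁.phase j).m v) := ⟨_, rfl⟩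
  obtain ⟨wrap, hwrap⟩ : ∃ f : ℝ → EuclideanSpace ℂ (Fin 3), f = fun t =>
      (2 * Real.pi * Complex.I * ((slotEnvelope W₁ j t : ℝ) : ℂ)) •
        (slotAmp W₁ j • exp ((t - t₀) • Bℝ) (coordL (R0 ν) (-(W₁.phase j).m) (N t₀ v)) +
          starRingEnd ℂ (slotAmp W₁ j) • exp ((t - t₀) • Bℝ) (coordL (R0 ν) (W₁.phase j).m (N t₀ v))) := ⟨_, rfl⟩
  -- pointwise split on the slot (p690140)
  have hsplit : ∀ t ∈ Icc t₀ (t₀ + L), tot t = fresh t + wrap t := by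
    intro t ht
    rw [htot, hfresh, hwrap]
    exact feedback_response_eq_of_mem_slot W₁ (ν • S) 1 (R0 ν) j hN hm hm' v ht
  -- continuity
  have htot_c : ContinuousOn tot (Icc t₀ (t₀ + L)) := by
    rw [htot]
    have h := (continuousOn_feedback_comp W₁ (ν • S) 1 (R0 ν) j j hN).mono (Icc_subset_Icc h0 h1P)
    have h' := h.clm_apply (continuousOn_const (c := v))
    refine h'.congr fun t _ => ?_
    simp only [ContinuousLinearMap.comp_apply, ContinuousLinearMap.coe_restrictScalars']
  have hEc : Continuous fun u : ℝ => exp (u • Bℝ) := continuous_iff_continuousAt.2 fun u => (hasDerivAt_exp_smul_const Bℝ u).continuousAt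
  have henvc : Continuous fun s : ℝ => ((slotEnvelope W₁ j s : ℝ) : ℂ) := Complex.continuous_ofReal.comp (continuous_slotEnvelope W₁ j)
  have hwrap_c : Continuous wrap := by
    rw [hwrap]
    refine ((continuous_const.mul henvc).smul ?_)
    exact ((((hEc.comp (continuous_id.sub continuous_const)).clm_apply continuous_const).const_smul (slotAmp W₁ j)).add
      (((hEc.comp (continuous_id.sub continuous_const)).clm_apply continuous_const).const_smul (starRingEnd ℂ (slotAmp W₁ j))))
  have hfresh_c : ContinuousOn fresh (Icc t₀ (t₀ + L)) := by
    have h : ∀ t ∈ Icc t₀ (t₀ + L), fresh t = tot t - wrap t := fun t ht => by rw [hsplit t ht, add_sub_cancel_right]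
    exact (htot_c.sub hwrap_c.continuousOn).congr h
  have hI_tot : IntervalIntegrable tot volume t₀ (t₀ + L) := htot_c.intervalIntegrable_of_Icc (by linarith)
  have hI_fresh : IntervalIntegrable fresh volume t₀ (t₀ + L) := hfresh_c.intervalIntegrable_of_Icc (by linarith)
  have hI_wrap : IntervalIntegrable wrap volume t₀ (t₀ + L) := hwrap_c.intervalIntegrable _ _
  -- the period mean is the slot integral of `tot` (p690833), applied to `v`
  have hMF : meanFeedback W₁ (ν • S) 1 (R0 ν) j j v = (1 / W₁.period) • ∫ t in t₀..t₀ + L, tot t := by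
    rw [meanFeedback_eq_slot_integral W₁ (ν • S) 1 (R0 ν) j j ⟨_, hN⟩, _root_.smul_apply,
      ContinuousLinearMap.intervalIntegral_apply (intervalIntegrable_feedback_comp W₁ (ν • S) 1 (R0 ν) j j hN h0 (by linarith) h1P) v]
    congr 1
    refine intervalIntegral.integral_congr fun t _ => ?_
    rw [htot]
    simp only [ContinuousLinearMap.comp_apply, ContinuousLinearMap.coe_restrictScalars', hNdef]
  have hsum : ∫ t in t₀..t₀ + L, tot t = (∫ t in t₀..t₀ + L, fresh t) + ∫ t in t₀..t₀ + L, wrap t := by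
    rw [← intervalIntegral.integral_add hI_fresh hI_wrap]
    refine intervalIntegral.integral_congr fun t ht => ?_
    rw [uIcc_of_le (by linarith)] at ht
    exact hsplit t ht
  have hF : ∫ t in t₀..t₀ + L, fresh t =
      (((4 * Real.pi ^ 2 / ν) * (M * W.period / ν) * slotCoef W j : ℝ) : ℂ) •
        Matrix.toEuclideanCLM (n := Fin 3) (𝕜 := ℂ) ((slotQ W M S j).map ((↑) : ℝ → ℂ)) v := by
    rw [hfresh]
    exact integral_fresh_eq W hM hν S 1 j v
  rw [hMF, hsum, hF, smul_add, hwrap, period_stretch_stretch W hM hν]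
  congr 1
  simp only [Complex.coe_smul, smul_smul]
  congr 1
  have hPW : W.period ≠ 0 := (period_pos W).ne'
  have hν0 : ν ≠ 0 := hν.ne'
  have hM0 : M ≠ 0 := hM.ne'
  field_simp

end Summit.AnomalousDissipation.AnomalousDissipation.Theorems.SolenoidalFractalHomogenisation.LagrangianStep.Sideband

end
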